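import Literature.AnabelianGeometry.EtaleTheta.Discharge.Sec2MonodromyModelTowerMembers
import Literature.AnabelianGeometry.EtaleTheta.Discharge.Sec2MonodromyModelSheetLemmas
import Literature.AnabelianGeometry.EtaleTheta.Discharge.Sec2Prop26TrueAtMonodromyModel
import HarnessLib

/-!
# [EtTh] Prop. 2.4 (characteristic nature of coverings) HOLDS at the monodromy model:
# `(monodromyModel l hl).Prop24`, every odd `l` — the instance form of FACT-LIST F-0609 is INHABITED (proof-only)

S. Mochizuki, *The étale theta function and its Frobenioid-theoretic manifestations* [EtTh], Publ. RIMS **45**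
(2009), §2 Prop. 2.4 (PDF p. 38): «any isomorphism of topological groups `Π^tp_{X̲̲_α} ⥲ Π^tp_{X̲̲_β}` (resp. `X̲`; `C̲̲`;
`C̲`) induces isomorphisms compatible with the various natural maps between the respective `Π^tp`'s of
`X̲̲, X̲, X, C̲̲, C̲, C, Ÿ` (resp. …)»; Rmk. 2.6.1 (p. 40) [cite: MochizukiEtTh2009, Prop 2.4 p.38]
[cite: MochizukiEtTh2009, Rmk 2.6.1 p.40].  Cell abc-iut, layer L2, seat abc-iut-w6-d084 (gen 7), «P26-NV MONODROMY TOY»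
STAGE 2b (abc-iut-L2-lead R1352).  PROOF-ONLY (no definition, no named fact).

WHAT IS PROVED.  For the typed one-object form `TemperedCoverData.Prop24` (FACT-LIST F-0609; universal closure REFUTED by
abc-iut-f-143's `TemperedModel.not_forall_prop24`, instance REFUTED at the κ′ cover p475371) there IS a datum where it
HOLDS: **`prop24_monodromyModel : (monodromyModel l hl).Prop24`** for every odd `l`; census pair
`prop24_instance_inhabited_and_closure_refuted`.  MECHANISM: the undotted members are the dotted ones times the sheet
`⟨e⟩ ≅ ℤ/2` of `Ÿ → Y` (`Π^tp_{X̲̲} ≅ ℤ × ℤ/2`, `Π^tp_{X̲} ≅ (ℤ/l × ℤ) × ℤ/2`, `Π^tp_{C̲̲} ≅ D_∞ × ℤ/2`,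
`Π^tp_{C̲} ≅ (ℤ/l × D_∞) × ℤ/2`, via `embCuE`); an automorphism of `A × ℤ/2` (no central involution in `A`) is
`(α, χ)` (`mulEquiv_prodTwo_census`); `α` extends as in the dotted case (`conj(ι)`, `conj(x^a)`, `halfShift k`,
`scaleAut u`) and `χ` extends to a sheet twist by a character of `D_∞` (reflection parity / rotation parity `t ↦ e t`);
all of these stabilise `Π^tp` of `X̲̲, X̲, X, C̲̲, C̲, Ÿ` (resp. the printed sub-lists).

HONEST LABEL (R1352): a DESIGNED tempered toy with print's monodromy combinatorics (`G_K := 1`; NOT a Tate curve, NOT the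
tempered fundamental group of a curve).  It witnesses CONSISTENCY of the typed interface with the typed Prop. 2.4
(non-vacuity of the cone's FACT binder `T.Prop24`), nothing about print's Prop. 2.4 (absolute anabelian geometry);
typed ≠ proved; no side is taken on [IUTchIII] Cor. 3.12 or on any author.
-/

noncomputable section

namespace Literature.AnabelianGeometry.EtaleTheta.ThetaCovers.MonodromyModel

open Multiplicative HeisenbergWitness TemperedModel DihedralGroup
open KummerWitness (map_equiv_eq_of_iff)

variable (l : ℕ)

/-! ## 1. Stabilising the six coordinate members `X̲̲, X̲, X, C̲̲, C̲, Ÿ` -/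

/-- Stabilisation of the six tempered members from stabilisation of `{b = 0}`, `{b = c = 0}`, `{d rotation}` and `Π^tp_Ÿ`.
(toy bookkeeping for [EtTh] Prop. 2.4 «compatible with `X̲̲, X̲, X, C̲̲, C̲, Ÿ`»; no claim about print)
[cite: MochizukiEtTh2009, Prop 2.4 p.38] -/
theorem stab_tower_of_basic (e : TG l ≃* TG l)
    (hB0 : ((heisB0 l).comap (PhiT l)).map e.toMonoidHom = (heisB0 l).comap (PhiT l))
    (hD : ((heisD l).comap (PhiT l)).map e.toMonoidHom = (heisD l).comap (PhiT l))
    (hX : ((heisPiX l).comap (PhiT l)).map e.toMonoidHom = (heisPiX l).comap (PhiT l))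
    (hY : (PiYddT l).map e.toMonoidHom = PiYddT l) :
    ∀ S ∈ [(heisD l ⊓ heisPiX l).comap (PhiT l), (heisB0 l ⊓ heisPiX l).comap (PhiT l), (heisPiX l).comap (PhiT l),
      (heisD l).comap (PhiT l), (heisB0 l).comap (PhiT l), PiYddT l], S.map e.toMonoidHom = S := by
  intro S hS
  simp only [List.mem_cons, List.mem_nil_iff, or_false] at hS
  rcases hS with rfl | rfl | rfl | rfl | rfl | rfl
  · rw [Subgroup.comap_inf, Subgroup.map_inf_eq _ _ e.toMonoidHom e.injective, hD, hX]
  · rw [Subgroup.comap_inf, Subgroup.map_inf_eq _ _ e.toMonoidHom e.injective, hB0, hX]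
  · exact hX
  · exact hD
  · exact hB0
  · exact hY

/-- Stabilisation of a list of subgroups is preserved by composition. (folklore; no claim about print)
[cite: MochizukiEtTh2009, Prop 2.4 p.38] -/
theorem stab_list_trans (e₁ e₂ : TG l ≃* TG l) (L : List (Subgroup (TG l)))
    (h₁ : ∀ S ∈ L, S.map e₁.toMonoidHom = S) (h₂ : ∀ S ∈ L, S.map e₂.toMonoidHom = S) :
    ∀ S ∈ L, S.map (e₁.trans e₂).toMonoidHom = S :=
  fun S hS => map_trans_eq _ _ _ (h₁ S hS) (h₂ S hS)

/-- `scaleAut u`, `halfShift k`, `conj(ι)` and the sheet twists by characters of `D_∞` stabilise all six members.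
(toy bookkeeping for [EtTh] Prop. 2.4; no claim about print) [cite: MochizukiEtTh2009, Prop 2.4 p.38] -/
theorem stab_tower_generators (hl : Odd l) (u : (ZMod l)ˣ) (k : ZMod 0) (χ' : DihedralGroup 0 →* Multiplicative (ZMod 2)) :
    let L := [(heisD l ⊓ heisPiX l).comap (PhiT l), (heisB0 l ⊓ heisPiX l).comap (PhiT l), (heisPiX l).comap (PhiT l),
      (heisD l).comap (PhiT l), (heisB0 l).comap (PhiT l), PiYddT l]
    (∀ S ∈ L, S.map (scaleAut l u).toMonoidHom = S) ∧ (∀ S ∈ L, S.map (halfShift l hl k).toMonoidHom = S) ∧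
      (∀ S ∈ L, S.map (MulAut.conj (iotaT l)).toMonoidHom = S) ∧
      ∀ S ∈ L, S.map (sheetTwist l (χ'.comp SemidirectProduct.rightHom)).toMonoidHom = S := by
  refine ⟨?_, ?_, ?_, ?_⟩
  · exact stab_tower_of_basic l _ (scaleAut_stabilises l u).1 (scaleAut_stabilises l u).2.1
      (scaleAut_stabilises l u).2.2.1 (stabilise_PiYddT l hl u k 0).1
  · exact stab_tower_of_basic l _ (halfShift_stabilises l hl k).1 (halfShift_stabilises l hl k).2.1
      (halfShift_stabilises l hl k).2.2.1 (stabilise_PiYddT l hl u k 0).2.1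
  · exact stab_tower_of_basic l _ (conj_iotaT_stabilises l).1 (conj_iotaT_stabilises l).2.1
      (conj_iotaT_stabilises l).2.2.1 (stabilise_PiYddT l hl u k 0).2.2.1
  · exact stab_tower_of_basic l _ (sheetTwist_stabilises l χ' _).1 (sheetTwist_stabilises l χ' _).1
      (sheetTwist_stabilises l χ' _).1 (sheetTwist_stabilises l χ' (heisB0 l)).2

/-- The sign automorphism `conj(ι)^{[m=−1]}` on `embCuE` and its stabilisation of all six members. (toy bookkeeping for
[EtTh] Prop. 2.4; no claim about print) [cite: MochizukiEtTh2009, Prop 2.4 p.38] -/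
theorem exists_signAut_tower (hl : Odd l) (m : ZMod 0) (hm : m = 1 ∨ m = -1) :
    ∃ C : TG l ≃* TG l,
      (∀ (c : Multiplicative (ZMod l)) (i : ZMod 0) (ε : Multiplicative (ZMod 2)),
          C (embCuE l ((c, r i), ε)) = embCuE l ((c, r (m * i)), ε)) ∧
      (∀ (c : Multiplicative (ZMod l)) (i : ZMod 0) (ε : Multiplicative (ZMod 2)),
          C (embCuE l ((c, sr i), ε)) = embCuE l ((c, sr (m * i)), ε)) ∧
      ∀ S ∈ [(heisD l ⊓ heisPiX l).comap (PhiT l), (heisB0 l ⊓ heisPiX l).comap (PhiT l), (heisPiX l).comap (PhiT l),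
        (heisD l).comap (PhiT l), (heisB0 l).comap (PhiT l), PiYddT l], S.map C.toMonoidHom = S := by
  rcases hm with rfl | rfl
  · exact ⟨MulEquiv.refl _, fun c i ε => by rw [one_mul]; rfl, fun c i ε => by rw [one_mul]; rfl,
      fun S _ => map_equiv_eq_of_iff _ _ fun g => Iff.rfl⟩
  · refine ⟨MulAut.conj (iotaT l), fun c i ε => ?_, fun c i ε => ?_,
      (stab_tower_generators l hl 1 0 1).2.2.1⟩
    · rw [(generators_embCuE l hl 1 0 1 c (r i) ε).2.2.1, (sr_conj_dihedral i).1, neg_one_mul]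
    · rw [(generators_embCuE l hl 1 0 1 c (sr i) ε).2.2.1, (sr_conj_dihedral i).2, neg_one_mul]

/-! ## 2. Characters of the dotted members extend to characters of `D_∞` -/

/-- A character of `ℤ` (resp. its value on `1`) with values in `ℤ/2` is realised by a power of the rotation parity on the
rotations of `D_∞`. (toy bookkeeping for [EtTh] Rmk. 2.6.1; no claim about print) [cite: MochizukiEtTh2009, Rmk 2.6.1 p.40] -/
theorem exists_character_on_rotations (y : Multiplicative (ZMod 2)) :
    ∃ χ' : DihedralGroup 0 →* Multiplicative (ZMod 2), ∀ n : ℤ, χ' (r n) = y ^ n := by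
  by_cases hy : y = 1
  · exact ⟨1, fun n => by rw [hy, one_zpow]; rfl⟩
  · refine ⟨rotParity, fun n => ?_⟩
    rw [eq_ofAdd_one_of_ne_one hy, rotParity_r, ← ofAdd_zsmul, zsmul_one]
    rfl

/-! ## 3. The four extension lemmas -/

section Extensions

/-- **`Π^tp_{C̲}`** (`≅ (ℤ/l × D_∞) × ℤ/2`): every automorphism extends to `TG l` stabilising all six members
(`Γ = scaleAut u ∘ halfShift k ∘ conj(ι)^{[m=−1]} ∘ sheetTwist χ'`). (the typed [EtTh] Prop. 2.4 (iv) AT THE MODEL; no claim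
about print) [cite: MochizukiEtTh2009, Prop 2.4 p.38] -/
theorem exists_extension_Cu (hl : Odd l) {Z : Subgroup (TG l)} (hZ : Z = (heisB0 l).comap (PhiT l)) (γ : Z ≃* Z) :
    ∃ Γ : TG l ≃* TG l, (∀ h : Z, (Γ h : TG l) = γ h) ∧
      ∀ S ∈ [(heisD l ⊓ heisPiX l).comap (PhiT l), (heisB0 l ⊓ heisPiX l).comap (PhiT l), (heisPiX l).comap (PhiT l),
        (heisD l).comap (PhiT l), (heisB0 l).comap (PhiT l), PiYddT l], S.map Γ.toMonoidHom = S := by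
  haveI : NeZero l := ⟨by rintro rfl; exact (Nat.not_odd_zero hl).elim⟩
  subst hZ
  have hrange : (embCuE l).range = (heisB0 l).comap (PhiT l) := by
    ext g; rw [MonoidHom.mem_range, (mem_undotted_iff l g).1]
    exact ⟨fun ⟨q, h⟩ => ⟨q, h.symm⟩, fun ⟨q, h⟩ => ⟨q, h.symm⟩⟩
  let e : ((Multiplicative (ZMod l) × DihedralGroup 0) × Multiplicative (ZMod 2)) ≃* ↥((heisB0 l).comap (PhiT l)) :=
    (MonoidHom.ofInjective (embCuE_injective l)).trans (MulEquiv.subgroupCongr hrange)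
  have he : ∀ q, ((e q : ↥((heisB0 l).comap (PhiT l))) : TG l) = embCuE l q := fun q => rfl
  -- no central involution in `ℤ/l × D_∞`
  have hA : ∀ z : Multiplicative (ZMod l) × DihedralGroup 0, (∀ a, a * z = z * a) → z * z = 1 → z = 1 := by
    rintro ⟨c, d⟩ hz hsq
    have hd : d = 1 := eq_one_of_commute_r_sr
      (by have := congrArg Prod.snd (hz (1, r 1)); simpa using this.symm)
      (by have := congrArg Prod.snd (hz (1, sr 0)); simpa using this.symm)
    have hc : toAdd c + toAdd c = 0 := by
      have := congrArg (fun p => toAdd p.1) hsq; simpa using this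
    have hu : IsUnit (2 : ZMod l) := by
      have := (ZMod.unitOfCoprime 2 (Nat.coprime_two_left.mpr hl)).isUnit; simpa using this
    have hc' : toAdd c = 0 := (hu.mul_right_eq_zero).mp (by rw [two_mul]; exact hc)
    exact Prod.ext (toAdd.injective hc') hd
  obtain ⟨α, χ, hφ⟩ := mulEquiv_prodTwo_census hA (e.trans (γ.trans e.symm))
  obtain ⟨_, m, k, ⟨u', rfl⟩, hm, hr, hs⟩ := mulEquiv_zmodProdDihedral_census l hl α
  obtain ⟨C, hCr, hCs, hC6⟩ := exists_signAut_tower l hl m hm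
  -- the character: `χ (c, d) = χ' d` with `χ' := χ ∘ inr`
  have hχ : ∀ c d, χ (c, d) = (χ.comp (MonoidHom.inr _ _)) d := fun c d => by
    rw [show ((c, d) : Multiplicative (ZMod l) × DihedralGroup 0) = (c, 1) * (1, d) by simp, map_mul,
      show χ (c, 1) = (χ.comp (MonoidHom.inl _ _)) c from rfl, monoidHom_zmod_two_eq_one_of_odd hl, one_mul]
    rfl
  set χ' := χ.comp (MonoidHom.inr (Multiplicative (ZMod l)) (DihedralGroup 0)) with hχ'
  refine ⟨(sheetTwist l (χ'.comp SemidirectProduct.rightHom)).trans ((C.trans (halfShift l hl k)).trans (scaleAut l u')),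
    fun h => ?_, ?_⟩
  · have hγ : (γ h : TG l) = embCuE l ((e.trans (γ.trans e.symm)) (e.symm h)) := by
      rw [← he]; simp only [MulEquiv.trans_apply, MulEquiv.apply_symm_apply]
    rw [hγ, show (h : TG l) = embCuE l (e.symm h) by rw [← he, MulEquiv.apply_symm_apply]]
    rcases e.symm h with ⟨⟨c, j | j⟩, ε⟩
    · rw [hφ, hr, hχ, MulEquiv.trans_apply, (generators_embCuE l hl u' k χ' c _ ε).2.2.2, MulEquiv.trans_apply,
        MulEquiv.trans_apply, hCr, (generators_embCuE l hl u' k χ' c _ _).2.1, dihedralShift_r,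
        (generators_embCuE l hl u' k χ' _ _ _).1, mul_comm (χ' (r j)) ε]
    · rw [hφ, hs, hχ, MulEquiv.trans_apply, (generators_embCuE l hl u' k χ' c _ ε).2.2.2, MulEquiv.trans_apply,
        MulEquiv.trans_apply, hCs, (generators_embCuE l hl u' k χ' c _ _).2.1, dihedralShift_sr,
        (generators_embCuE l hl u' k χ' _ _ _).1, mul_comm (χ' (sr j)) ε]
  · exact stab_list_trans l _ _ _ (stab_tower_generators l hl u' k χ').2.2.2
      (stab_list_trans l _ _ _ (stab_list_trans l _ _ _ hC6 (stab_tower_generators l hl u' k χ').2.1)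
        (stab_tower_generators l hl u' k χ').1)

/-- **`Π^tp_{C̲̲}`** (`≅ D_∞ × ℤ/2`): every automorphism extends to `TG l` stabilising all six members
(`Γ = halfShift k ∘ conj(ι)^{[m=−1]} ∘ sheetTwist χ`). (the typed [EtTh] Prop. 2.4 (iii) AT THE MODEL; no claim about print)
[cite: MochizukiEtTh2009, Prop 2.4 p.38] -/
theorem exists_extension_Cuu (hl : Odd l) {Z : Subgroup (TG l)} (hZ : Z = (heisD l).comap (PhiT l)) (γ : Z ≃* Z) :
    ∃ Γ : TG l ≃* TG l, (∀ h : Z, (Γ h : TG l) = γ h) ∧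
      ∀ S ∈ [(heisD l ⊓ heisPiX l).comap (PhiT l), (heisB0 l ⊓ heisPiX l).comap (PhiT l), (heisPiX l).comap (PhiT l),
        (heisD l).comap (PhiT l), (heisB0 l).comap (PhiT l), PiYddT l], S.map Γ.toMonoidHom = S := by
  subst hZ
  let ψ : DihedralGroup 0 × Multiplicative (ZMod 2) →* TG l :=
    (embCuE l).comp ((MonoidHom.inr (Multiplicative (ZMod l)) (DihedralGroup 0)).prodMap (MonoidHom.id _))
  have hψapply : ∀ d ε, ψ (d, ε) = embCuE l ((1, d), ε) := fun d ε => rfl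
  have hψ : Function.Injective ψ := by
    rintro ⟨d, ε⟩ ⟨d', ε'⟩ h
    rw [hψapply, hψapply] at h
    have h2 := embCuE_injective l h
    simp only [Prod.mk.injEq] at h2
    exact Prod.ext h2.1.2 h2.2
  have hrange : ψ.range = (heisD l).comap (PhiT l) := by
    ext g; rw [MonoidHom.mem_range, (mem_undotted_iff l g).2.1]
    exact ⟨fun ⟨⟨d, ε⟩, h⟩ => ⟨d, ε, h.symm⟩, fun ⟨d, ε, h⟩ => ⟨(d, ε), h.symm⟩⟩
  let e : (DihedralGroup 0 × Multiplicative (ZMod 2)) ≃* ↥((heisD l).comap (PhiT l)) :=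
    (MonoidHom.ofInjective hψ).trans (MulEquiv.subgroupCongr hrange)
  have he : ∀ q, ((e q : ↥((heisD l).comap (PhiT l))) : TG l) = embCuE l ((1, q.1), q.2) := fun q => rfl
  have hA : ∀ z : DihedralGroup 0, (∀ a, a * z = z * a) → z * z = 1 → z = 1 := fun z hz _ =>
    eq_one_of_commute_r_sr (hz (r 1)).symm (hz (sr 0)).symm
  obtain ⟨α, χ, hφ⟩ := mulEquiv_prodTwo_census hA (e.trans (γ.trans e.symm))
  obtain ⟨m, k, hm, hr, hs⟩ := mulEquiv_dihedralZero_census α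
  obtain ⟨C, hCr, hCs, hC6⟩ := exists_signAut_tower l hl m hm
  refine ⟨(sheetTwist l (χ.comp SemidirectProduct.rightHom)).trans (C.trans (halfShift l hl k)), fun h => ?_, ?_⟩
  · have hγ : (γ h : TG l) =
        embCuE l ((1, ((e.trans (γ.trans e.symm)) (e.symm h)).1), ((e.trans (γ.trans e.symm)) (e.symm h)).2) := by
      rw [← he]; simp only [MulEquiv.trans_apply, MulEquiv.apply_symm_apply]
    rw [hγ, show (h : TG l) = embCuE l ((1, (e.symm h).1), (e.symm h).2) by rw [← he, MulEquiv.apply_symm_apply]]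
    rcases e.symm h with ⟨j | j, ε⟩
    · rw [hφ, hr, MulEquiv.trans_apply, (generators_embCuE l hl 1 k χ 1 _ ε).2.2.2, MulEquiv.trans_apply, hCr,
        (generators_embCuE l hl 1 k χ 1 _ _).2.1, dihedralShift_r, mul_comm (χ (r j)) ε]
    · rw [hφ, hs, MulEquiv.trans_apply, (generators_embCuE l hl 1 k χ 1 _ ε).2.2.2, MulEquiv.trans_apply, hCs,
        (generators_embCuE l hl 1 k χ 1 _ _).2.1, dihedralShift_sr, mul_comm (χ (sr j)) ε]
  · exact stab_list_trans l _ _ _ (stab_tower_generators l hl 1 k χ).2.2.2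
      (stab_list_trans l _ _ _ hC6 (stab_tower_generators l hl 1 k χ).2.1)

/-- **`Π^tp_{X̲̲}`** (`≅ ℤ × ℤ/2`): every automorphism extends to `TG l` stabilising all six members
(`Γ = conj(ι)^{[m=−1]} ∘ sheetTwist (rotation parity)^{[χ(t)=e]}` — the twist `t ↦ e t` IS an automorphism of the model).
(the typed [EtTh] Prop. 2.4 (i) AT THE MODEL; no claim about print) [cite: MochizukiEtTh2009, Prop 2.4 p.38] -/
theorem exists_extension_Xuu (hl : Odd l) {Z : Subgroup (TG l)} (hZ : Z = (heisD l ⊓ heisPiX l).comap (PhiT l))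
    (γ : Z ≃* Z) :
    ∃ Γ : TG l ≃* TG l, (∀ h : Z, (Γ h : TG l) = γ h) ∧
      ∀ S ∈ [(heisD l ⊓ heisPiX l).comap (PhiT l), (heisB0 l ⊓ heisPiX l).comap (PhiT l), (heisPiX l).comap (PhiT l),
        (heisD l).comap (PhiT l), (heisB0 l).comap (PhiT l), PiYddT l], S.map Γ.toMonoidHom = S := by
  subst hZ
  let ψ : Multiplicative ℤ × Multiplicative (ZMod 2) →* TG l :=
    (embCuE l).comp (((MonoidHom.inr (Multiplicative (ZMod l)) (DihedralGroup 0)).comp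
      (zpowersHom (DihedralGroup 0) (r 1))).prodMap (MonoidHom.id _))
  have hψapply : ∀ n ε, ψ (n, ε) = embCuE l ((1, r (toAdd n : ℤ)), ε) := fun n ε => by
    change embCuE l ((1, (r 1) ^ (toAdd n)), ε) = _
    rw [r_one_zpow_int]
    rfl
  have hψ : Function.Injective ψ := by
    rintro ⟨n, ε⟩ ⟨n', ε'⟩ h
    rw [hψapply, hψapply] at h
    have h2 := embCuE_injective l h
    simp only [Prod.mk.injEq] at h2
    have h3 : (toAdd n : ℤ) = toAdd n' := by injection h2.1.2
    exact Prod.ext (toAdd.injective h3) h2.2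
  have hrange : ψ.range = (heisD l ⊓ heisPiX l).comap (PhiT l) := by
    ext g; rw [MonoidHom.mem_range, (mem_undotted_iff l g).2.2.2]
    constructor
    · rintro ⟨⟨n, ε⟩, h⟩; exact ⟨_, ε, by rw [← h, hψapply]⟩
    · rintro ⟨j, ε, h⟩; exact ⟨(ofAdd j, ε), by rw [hψapply, toAdd_ofAdd, h]⟩
  let e : (Multiplicative ℤ × Multiplicative (ZMod 2)) ≃* ↥((heisD l ⊓ heisPiX l).comap (PhiT l)) :=
    (MonoidHom.ofInjective hψ).trans (MulEquiv.subgroupCongr hrange)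
  have he : ∀ q, ((e q : ↥((heisD l ⊓ heisPiX l).comap (PhiT l))) : TG l) = embCuE l ((1, r (toAdd q.1 : ℤ)), q.2) :=
    fun q => hψapply q.1 q.2
  obtain ⟨α, χ, hφ⟩ := mulEquiv_prodTwo_census int_no_involution (e.trans (γ.trans e.symm))
  obtain ⟨m, hm, hα⟩ := mulEquiv_int_census α
  obtain ⟨C, hCr, -, hC6⟩ := exists_signAut_tower l hl m hm
  obtain ⟨χ', hχ'⟩ := exists_character_on_rotations (χ (ofAdd 1))
  have hχ : ∀ n : Multiplicative ℤ, χ n = χ' (r (toAdd n : ℤ)) := fun n => by rw [hχ', monoidHom_int_two χ n]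
  refine ⟨(sheetTwist l (χ'.comp SemidirectProduct.rightHom)).trans C, fun h => ?_, ?_⟩
  · have hγ : (γ h : TG l) = embCuE l ((1, r (toAdd ((e.trans (γ.trans e.symm)) (e.symm h)).1 : ℤ)),
        ((e.trans (γ.trans e.symm)) (e.symm h)).2) := by
      rw [← he]; simp only [MulEquiv.trans_apply, MulEquiv.apply_symm_apply]
    rw [hγ, show (h : TG l) = embCuE l ((1, r (toAdd (e.symm h).1 : ℤ)), (e.symm h).2) by
      rw [← he, MulEquiv.apply_symm_apply]]
    rcases e.symm h with ⟨n, ε⟩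
    rw [hφ, hα, toAdd_ofAdd, hχ, MulEquiv.trans_apply, (generators_embCuE l hl 1 0 χ' 1 _ ε).2.2.2, hCr,
      mul_comm (χ' _) ε]
    rfl
  · exact stab_list_trans l _ _ _ (stab_tower_generators l hl 1 0 χ').2.2.2 hC6

/-- **`Π^tp_{X̲}`** (`≅ (ℤ/l × ℤ) × ℤ/2`): every automorphism extends to `TG l` stabilising `Π^tp_{X̲}, Π^tp_X, Π^tp_Ÿ`
(`Γ = scaleAut u ∘ conj(x^a) ∘ conj(ι)^{[m=−1]} ∘ sheetTwist χ'`, `a = −k u⁻¹ m`). (the typed [EtTh] Prop. 2.4 (ii) AT THE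
MODEL; no claim about print) [cite: MochizukiEtTh2009, Prop 2.4 p.38] -/
theorem exists_extension_Xu [NeZero l] (hl : Odd l) {Z : Subgroup (TG l)} (hZ : Z = (heisB0 l ⊓ heisPiX l).comap (PhiT l))
    (γ : Z ≃* Z) :
    ∃ Γ : TG l ≃* TG l, (∀ h : Z, (Γ h : TG l) = γ h) ∧
      ∀ S ∈ [Z, (heisPiX l).comap (PhiT l), PiYddT l], S.map Γ.toMonoidHom = S := by
  subst hZ
  let ιA : Multiplicative (ZMod l × ℤ) →* Multiplicative (ZMod l) × DihedralGroup 0 :=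
    MonoidHom.mk' (fun x => (ofAdd (toAdd x).1, r ((toAdd x).2 : ℤ))) fun x y =>
      Prod.ext (by simp only [toAdd_mul, Prod.fst_add, ofAdd_add, Prod.fst_mul])
        (by change r ((toAdd (x * y)).2 : ℤ) = r ((toAdd x).2 : ℤ) * r ((toAdd y).2 : ℤ)
            rw [r_mul_r, toAdd_mul, Prod.snd_add]; rfl)
  let ψ : Multiplicative (ZMod l × ℤ) × Multiplicative (ZMod 2) →* TG l := (embCuE l).comp (ιA.prodMap (MonoidHom.id _))
  have hψapply : ∀ q, ψ q = embCuE l ((ofAdd (toAdd q.1).1, r ((toAdd q.1).2 : ℤ)), q.2) := fun q => rfl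
  have hψ : Function.Injective ψ := by
    rintro ⟨a, ε⟩ ⟨b, ε'⟩ h
    rw [hψapply, hψapply] at h
    have h2 := embCuE_injective l h
    simp only [Prod.mk.injEq] at h2
    have h3 : ((toAdd a).2 : ℤ) = (toAdd b).2 := by injection h2.1.2
    exact Prod.ext (toAdd.injective (Prod.ext (ofAdd.injective h2.1.1) h3)) h2.2
  have hrange : ψ.range = (heisB0 l ⊓ heisPiX l).comap (PhiT l) := by
    ext g; rw [MonoidHom.mem_range, (mem_undotted_iff l g).2.2.1]
    constructor
    · rintro ⟨q, h⟩; exact ⟨_, _, _, by rw [← h, hψapply]⟩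
    · rintro ⟨c, j, ε, h⟩; exact ⟨(ofAdd (c, j), ε), by rw [hψapply, toAdd_ofAdd, h]⟩
  let e : (Multiplicative (ZMod l × ℤ) × Multiplicative (ZMod 2)) ≃* ↥((heisB0 l ⊓ heisPiX l).comap (PhiT l)) :=
    (MonoidHom.ofInjective hψ).trans (MulEquiv.subgroupCongr hrange)
  have he : ∀ q, ((e q : ↥((heisB0 l ⊓ heisPiX l).comap (PhiT l))) : TG l) =
      embCuE l ((ofAdd (toAdd q.1).1, r ((toAdd q.1).2 : ℤ)), q.2) := fun q => hψapply q
  obtain ⟨α, χ, hφ⟩ := mulEquiv_prodTwo_census (zmodProdInt_no_involution hl) (e.trans (γ.trans e.symm))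
  obtain ⟨_, k, m, ⟨u', rfl⟩, hm, hα⟩ := mulEquiv_zmodProdInt_census l α
  obtain ⟨C, hCr, -, hC6⟩ := exists_signAut_tower l hl m hm
  -- the character: trivial on the torsion `ℤ/l`, a power of the rotation parity on `ℤ`
  obtain ⟨χ', hχ'⟩ := exists_character_on_rotations (χ (ofAdd (0, 1)))
  have hχ : ∀ x : Multiplicative (ZMod l × ℤ), χ x = χ' (r ((toAdd x).2 : ℤ)) := fun x => by
    have htor : χ (ofAdd ((toAdd x).1, 0)) = 1 := by
      have := monoidHom_zmod_two_eq_one_of_odd hl (χ.comp (AddMonoidHom.inl (ZMod l) ℤ).toMultiplicative)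
        (ofAdd (toAdd x).1)
      exact this
    conv_lhs => rw [← ofAdd_toAdd x, ← Prod.mk.eta (p := toAdd x), ofAdd_pair_eq, map_mul, htor, one_mul, map_zpow]
    rw [hχ']
  -- the twist parameter `a = -k u⁻¹ m`
  have hm2 : (m : ZMod l) * (m : ZMod l) = 1 := by rcases hm with rfl | rfl <;> simp
  have huinv : ((u' : ZMod l)) * ↑u'⁻¹ = 1 := Units.mul_inv u'
  have key : ∀ (x1 : ZMod l) (i : ZMod 0),
      (u' : ZMod l) * (x1 - ZMod.castHom (dvd_zero l) (ZMod l) (HMul.hMul (α := ZMod 0) (β := ZMod 0) m i) *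
        -(k * ↑u'⁻¹ * (m : ZMod l))) = ↑u' * x1 + k * @Int.cast (ZMod l) _ i := fun x1 i => by
    have hc1 : ZMod.castHom (dvd_zero l) (ZMod l) (m : ZMod 0) = (m : ZMod l) := rfl
    have hc2 : ZMod.castHom (dvd_zero l) (ZMod l) i = @Int.cast (ZMod l) _ i := rfl
    rw [map_mul, hc1, hc2]
    linear_combination (k * (@Int.cast (ZMod l) _ i) * (m : ZMod l) ^ 2) * huinv + (k * (@Int.cast (ZMod l) _ i)) * hm2
  have hxstab : ∀ S ∈ [(heisB0 l ⊓ heisPiX l).comap (PhiT l), (heisPiX l).comap (PhiT l), PiYddT l],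
      S.map (MulAut.conj (xElt l (-(k * ↑u'⁻¹ * (m : ZMod l))))).toMonoidHom = S := by
    intro S hS
    simp only [List.mem_cons, List.mem_nil_iff, or_false] at hS
    rcases hS with rfl | rfl | rfl
    · exact (conj_xElt_stabilises l _).1
    · exact map_equiv_eq_of_iff _ _ fun g => by
        rw [(mem_members_iff l _).2.2.1, (mem_members_iff l _).2.2.1, (conj_xElt_coords l _ g).1]
    · exact (stabilise_PiYddT l hl u' 0 _).2.2.2
  have hsub : ∀ (f : TG l ≃* TG l), (∀ S ∈ [(heisD l ⊓ heisPiX l).comap (PhiT l), (heisB0 l ⊓ heisPiX l).comap (PhiT l),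
      (heisPiX l).comap (PhiT l), (heisD l).comap (PhiT l), (heisB0 l).comap (PhiT l), PiYddT l], S.map f.toMonoidHom = S) →
      ∀ S ∈ [(heisB0 l ⊓ heisPiX l).comap (PhiT l), (heisPiX l).comap (PhiT l), PiYddT l], S.map f.toMonoidHom = S := by
    intro f hf S hS
    simp only [List.mem_cons, List.mem_nil_iff, or_false] at hS
    rcases hS with rfl | rfl | rfl
    · exact hf _ (by simp)
    · exact hf _ (by simp)
    · exact hf _ (by simp)
  refine ⟨(sheetTwist l (χ'.comp SemidirectProduct.rightHom)).trans
      ((C.trans (MulAut.conj (xElt l (-(k * ↑u'⁻¹ * (m : ZMod l)))))).trans (scaleAut l u')), fun h => ?_, ?_⟩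
  · have hγ : (γ h : TG l) = embCuE l ((ofAdd (toAdd ((e.trans (γ.trans e.symm)) (e.symm h)).1).1,
        r ((toAdd ((e.trans (γ.trans e.symm)) (e.symm h)).1).2 : ℤ)), ((e.trans (γ.trans e.symm)) (e.symm h)).2) := by
      rw [← he]; simp only [MulEquiv.trans_apply, MulEquiv.apply_symm_apply]
    rw [hγ, show (h : TG l) = embCuE l ((ofAdd (toAdd (e.symm h).1).1, r ((toAdd (e.symm h).1).2 : ℤ)), (e.symm h).2) by
      rw [← he, MulEquiv.apply_symm_apply]]
    rcases e.symm h with ⟨x, ε⟩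
    have hαx : α x = ofAdd (↑u' * (toAdd x).1 + k * ((toAdd x).2 : ZMod l), m * (toAdd x).2) := by
      have h1 := hα (toAdd x).1 (toAdd x).2
      rwa [Prod.mk.eta, ofAdd_toAdd] at h1
    rw [hφ, hαx, toAdd_ofAdd, hχ]
    dsimp only
    rw [MulEquiv.trans_apply, (generators_embCuE l hl u' 0 χ' _ _ ε).2.2.2, MulEquiv.trans_apply, MulEquiv.trans_apply,
      hCr, conj_xElt_embCuE_r, (generators_embCuE l hl u' 0 χ' _ _ _).1, toAdd_ofAdd, key,
      mul_comm (χ' _) ε]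
    rfl
  · exact stab_list_trans l _ _ _ (hsub _ (stab_tower_generators l hl u' 0 χ').2.2.2)
      (stab_list_trans l _ _ _ (stab_list_trans l _ _ _ (hsub _ hC6) hxstab) (hsub _ (stab_tower_generators l hl u' 0 χ').1))

end Extensions

/-! ## 4. Prop. 2.4 at the monodromy model; the census pair for F-0609 -/

section Model

variable [NeZero l]

/-- **[EtTh] Prop. 2.4 AS TYPED (`TemperedCoverData.Prop24`, FACT-LIST F-0609) HOLDS at the monodromy model**, for every
odd `l`.  First INHABITED instance of the F-0609 instance form in the tree (it FAILS at the toy of record p435476 and at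
the κ′ cover p475371).  CONSISTENCY of the typed interface + typed Prop. 2.4 only; nothing about print's Prop. 2.4.
[cite: MochizukiEtTh2009, Prop 2.4 p.38] -/
theorem prop24_monodromyModel (hl : Odd l) : (monodromyModel l hl).Prop24 := by
  have hT : (monodromyModel l hl).tower = [(heisD l ⊓ heisPiX l).comap (PhiT l), (heisB0 l ⊓ heisPiX l).comap (PhiT l),
      (heisPiX l).comap (PhiT l), (heisD l).comap (PhiT l), (heisB0 l).comap (PhiT l), PiYddT l] := by
    rw [TemperedCoverData.tower, tp_PiXuu, tp_PiXu, tp_PiX, tp_PiCuu, tp_PiCu]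
  have main : ∀ {Z : Subgroup (TG l)} {L : List (Subgroup (TG l))},
      (∀ γ' : Z ≃* Z, ∃ Γ : TG l ≃* TG l, (∀ h : Z, (Γ h : TG l) = γ' h) ∧ ∀ S ∈ L, S.map Γ.toMonoidHom = S) →
      ∀ γ : Z ≃ₜ* Z, (monodromyModel l hl).ExtendsStabilising Z γ L := by
    intro Z L hex γ
    obtain ⟨Γ, hΓ, hL⟩ := hex γ.toMulEquiv
    obtain ⟨Γ', hΓ'⟩ := exists_continuousMulEquiv_of_mulEquiv l Γ
    refine ⟨Γ', fun h => by rw [hΓ']; exact hΓ h, fun S hS => ?_⟩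
    rw [show Γ'.toMulEquiv.toMonoidHom = Γ.toMonoidHom from MonoidHom.ext hΓ']
    exact hL S hS
  refine ⟨fun γ => ?_, fun γ => ?_, fun γ => ?_, fun γ => ?_⟩
  · rw [hT]; exact main (fun γ' => exists_extension_Xuu l hl (tp_PiXuu l hl) γ') γ
  · rw [tp_PiX]
    exact main (fun γ' => exists_extension_Xu l hl (tp_PiXu l hl) γ') γ
  · rw [hT]; exact main (fun γ' => exists_extension_Cuu l hl (tp_PiCuu l hl) γ') γ
  · rw [tp_PiXu, tp_PiX]
    refine main (fun γ' => ?_) γ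
    obtain ⟨Γ, hΓ, h6⟩ := exists_extension_Cu l hl (tp_PiCu l hl) γ'
    refine ⟨Γ, hΓ, fun S hS => h6 S ?_⟩
    rw [tp_PiCu] at hS
    simp only [List.mem_cons, List.mem_nil_iff, or_false] at hS ⊢
    rcases hS with rfl | rfl | rfl | rfl <;> simp

/-- **The instance form of F-0609 is INHABITED**: a `TemperedCoverData l` (`l` odd) at which the typed Prop. 2.4 AND the
typed Prop. 2.6 hold, with `K ⊇ μ_l`. (consistency witness; no claim about print) [cite: MochizukiEtTh2009, Prop 2.4 p.38] -/
theorem exists_temperedCoverData_prop24_prop26 (hl : Odd l) :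
    ∃ T : TemperedCoverData.{0} l, T.Prop24 ∧ T.Prop26 ∧ T.HasMuL :=
  ⟨monodromyModel l hl, prop24_monodromyModel l hl, prop26_monodromyModel l hl, hasMuL_monodromyModel l hl⟩

/-- **Census pair for F-0609 / node EtTh:Prop2.4**: instance form INHABITED (monodromy model) while the universal closure is
REFUTED (abc-iut-f-143's `TemperedModel.not_forall_prop24`), every odd `l ≠ 1`. (no claim about print; refuted-as-typed ≠
refuted-in-print) [cite: MochizukiEtTh2009, Prop 2.4 p.38] -/
theorem prop24_instance_inhabited_and_closure_refuted (hl : Odd l) (hl1 : l ≠ 1) :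
    (∃ T : TemperedCoverData.{0} l, T.Prop24 ∧ T.Prop26 ∧ T.HasMuL) ∧ ¬ ∀ T : TemperedCoverData.{0} l, T.Prop24 :=
  ⟨exists_temperedCoverData_prop24_prop26 l hl, TemperedModel.not_forall_prop24 l hl hl1⟩

end Model

end Literature.AnabelianGeometry.EtaleTheta.ThetaCovers.MonodromyModel

end
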